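/-
Copyright (c) 2026 the pub-hodgecm-mathlib formalisation cell (harness21).  Prover seat hodgecm-mathlib-LH4-p01 (g9), 2026-09-02.  LH4 road «M6 ROW 2 ★ DYADIC TWIN»
(LEAD F0P3a-plan T14-66; LH4-plan (g8) WORD #38 DEAL g8-#7, brick F4-b′): the (D2-γ-CM) parity at the place WITHOUT `|2|_w = 1`, on B-p04 (g47)'s ★ UNIFORM core.
-/
import Literature.NumberTheory.Automorphic.TypeTwoSelfDualCyclicParity        -- ★ (D2-γ-CM) p846702 (B-p14 (g37)): the `|2| = 1` original; brings ★ seam p846609, ★ frame p846649, the bridge and `exists_poly_eval_mul_eq_one`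
import Literature.NumberTheory.Automorphic.RationalGoodVectorParityUniform    -- ★ p851636 (B-p04 (g47)): `exists_rational_good_iff_even_uniform` — the 2-free core (its first consumer is THIS file)
import HarnessLib

/-!
# (D2-γ-CM)″ «A SELF-DUAL `τ`-CYCLIC LATTICE EXISTS IFF `ord_E d₀ + n` IS EVEN», UNIFORMISER FRAME, ANY RESIDUE CHARACTERISTIC

Topic `NumberTheory/Automorphic`; namespace `Literature.NumberTheory.Automorphic.SymmetricEigenframe` (★'s).  ONE THEOREM (no definition, no instance, no notation, no named fact, no
`sorry`); kernel lane `--supports stmt-HodgeConjecture-24833`.  Cell `pub/hodgecm-mathlib` (D-0151), crux H413 = `stmt-HodgeConjecture-24833`; LH4 road «M6 ROW 2 ★ DYADIC TWIN»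
(LEAD T14-66 «ROAD-LIMITED GO», dealer LH4-plan (g8) WORD #38 g8-#7; sigsheet `F0/P3c/LH4/LH4-p01/g9/o4/f4a/SIG-F4b-TypeTwoSelfDualCyclicParityUniform.v1.LH4p01g9.md`).
**Statement = ★ (D2-γ-CM) `exists_selfDual_cyclic_iff_even_log` (`TypeTwoSelfDualCyclicParity.lean`) TOKEN FOR TOKEN, with: the binder `h2 : Valued.v (2 : E) = 1` DELETED; the
skew-unit binders `{δE} hσδE hδEv` (an input of the TAME core only) DELETED; the trace-one binder `htr` DELETED (derived inside); ADDED `h20 : (2 : E) ≠ 0` (characteristic 0 — true at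
`p = 2`; used only for `Fix ι = j(E)`) and the LINEAR-SYMMETRISER SEED `ω ∈ E`, `|ω| ≤ 1`, `|ω + σω| = 1` (it exists at every inert-UNRAMIFIED place: ★ p851638
`exists_v_eq_one_v_add_galAdicCompletionMap_eq_one`); conclusion VERBATIM.**  UNIFORMISER FRAME: the eigen-field datum is ★ (D2-β)'s `θ` with `|θ| = exp(−1)`, `ιθ = −θ` — the
TAME row and the ODD-ORDER WILD row (`ord_w disc χ_g` odd); the wild UNIT-discriminant rows need the Eisenstein frame (★ p851611) and are NOT claimed here.  SUPERSEDES NOTHING —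
★ (D2-γ-CM) keeps its consumers (★ `…RowTwoPlace`).
HONEST LABEL: HC_CM is proved only modulo the 7 printed citations (2 remaining named inputs: hLiu418 = stmt-HodgeConjecture-24832, h413 = stmt-HodgeConjecture-24833) until rung 0
closes; unconditional local algebra, count-neutral (pays no organ, opens no road; zero label movement until F5 ★ and a desk-priced rider).

WHAT CHANGES IN THE PROOF (everything else is ★'s verbatim): §0 `2 ≠ 0` in `K` from `h20` through `j`; §2 the four tame facts `|1 + γᵢ| = 1` (the Cayley symmetriser of the tame
core, `|2| = 1` in substance) and the skew unit `δ` are GONE — the uniform core wants the DEPTH-ZERO facts `|γᵢ − 1| < 1` instead (`hu1`, `hlam1`, `ι` isometric); §5 the frame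
parity (ODD, via the `ι`-anti-fixed uniformiser `θ`) is unchanged; §6 `htr` is built from the seed (`b := ω∕(ω + σω)`), the seam ★ `exists_selfDual_cyclic_iff_exists_rational_good`
is unchanged, and the core is ★ `exists_rational_good_iff_even_uniform` with seed `jω`, `L := −(2N+1)` and the parity token `Even(½log|d₀| + log|d₁| + L)` = (odd) + (odd).
No `IsUnit 2`, no `|2| = 1`, no `d(K₂∕L_w)` binder (T14-66 KILL clause honoured).

## References
* [Rogawski1990] J. D. Rogawski, *Automorphic Representations of Unitary Groups in Three Variables* (1990): §4.9 Lemma 4.9.3 p. 56, Prop. 4.9.1 (b) p. 55.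
* [Jacobowitz1962] R. Jacobowitz, *Hermitian forms over local fields*, Amer. J. Math. 84 (1962): §5, §7 Thm. 7.1, §§9–11.
* [Kottwitz1986] R. E. Kottwitz, *Base change for unit elements of Hecke algebras*, Compositio Math. 60 (1986): §3.
* [SerreLocalFields1979] J.-P. Serre, *Local Fields*, GTM 67 (1979): Ch. V §2 Prop. 3.
-/

set_option autoImplicit false

noncomputable section

open Finset Matrix Polynomial
open scoped MatrixGroups ValuativeRel WithZero
open ValuativeRel

namespace Literature.NumberTheory.Automorphic.SymmetricEigenframe

open Literature.NumberTheory.Automorphic Literature.NumberTheory.Automorphic.UnitaryGroup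

/-- **(D2-γ-CM)″ «A SELF-DUAL `τ`-CYCLIC LATTICE EXISTS IFF `ord_E d₀ + n` IS EVEN», UNIFORMISER FRAME, ANY RESIDUE CHARACTERISTIC** — the conclusion of ★
`exists_selfDual_cyclic_iff_even_log` verbatim; binders: `h2`, `{δE} hσδE hδEv`, `htr` deleted; `h20 : (2:E) ≠ 0` and the seed `ω` (`|ω| ≤ 1`, `|ω + σω| = 1`) added; the parity core
is ★ `exists_rational_good_iff_even_uniform` (see the module docstring).
[cite: Rogawski1990, §4.9 Lemma 4.9.3 p. 56, Prop. 4.9.1 (b) p. 55] [cite: Jacobowitz1962, §5, §7 Thm. 7.1] [cite: Kottwitz1986, §3] -/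
theorem exists_selfDual_cyclic_iff_even_log_uniform
    {E K : Type*} [Field E] [Valued E ℤᵐ⁰] [ValuativeRel E] [(Valued.v : Valuation E ℤᵐ⁰).Compatible]
    [Field K] [Valued K ℤᵐ⁰] [ValuativeRel K] [(Valued.v : Valuation K ℤᵐ⁰).Compatible]
    -- the CM place `E = L_w`: `σ = σ_w` (★ `galAdicCompletionMap_galAdicCompletionMap_of_smul_eq`, ★ `mem_integer_galAdicCompletionMap`,
    -- ★ `UnramifiedQuadraticNorm.exists_mul_map_eq_of_isUnit_integer`), `2 ≠ 0` (characteristic 0) and the linear-symmetriser seed `ω` (★ p851638)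
    (σ : E →+* E) (hσσ : ∀ x, σ (σ x) = x) (hσO : ∀ x : 𝒪[E], σ x ∈ 𝒪[E])
    (hnorm : ∀ u : 𝒪[E], IsUnit u → σ u = u → ∃ t : 𝒪[E], (t : E) * σ t = u)
    (h20 : (2 : E) ≠ 0) {ω : E} (hω : Valued.v ω ≤ 1) (hωtr : Valued.v (ω + σ ω) = 1)
    -- the hyperspecial hermitian form and the type-(2) unitary `τ` with its one-place data (★ (D1) A-p12 (g22): `hJ hJh hτU hχ hσu hu1 hx₀ hx₀0`)
    (J : GL (Fin 3) E) (hJ : J ∈ glInt 3 E) (hJh : ((J : Matrix (Fin 3) (Fin 3) E).map σ)ᵀ = J)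
    (τ : Matrix (Fin 3) (Fin 3) E) (hτU : (τ.map σ)ᵀ * (J : Matrix (Fin 3) (Fin 3) E) * τ = J)
    {u t D : E} (hχ : τ.charpoly = (X - C u) * (X ^ 2 - C t * X + C D))
    (hσu : σ u * u = 1) (hu1 : Valued.v (u - 1) < 1)
    {x₀ : Fin 3 → E} (hx₀ : τ *ᵥ x₀ = u • x₀) (hx₀0 : x₀ ≠ 0)
    -- the ramified eigen-field `j = ι₁ : E → K` (★ `valued_toPlace_of_ramificationIdx'_eq_two`) and the (D2-β) package VERBATIM (★ p846663 `exists_eigenField_package`: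
    -- `hs'ι hs'θ hs's' hs'v`, `hι'ι hι'θ hι'ι' hι'v hcomm`, `hθv hcoord`, `hquad hlamO hlam1 hnorm1 hne hexpn hexpN`, `hrE hnK hnE`)
    (j : E →+* K) (hjv : ∀ x, Valued.v (j x) = Valued.v x ^ 2)
    (σK ι : K →+* K) (hσj : ∀ x, σK (j x) = j (σ x)) (hσKσK : ∀ y, σK (σK y) = y) (hσKv : ∀ y, Valued.v (σK y) = Valued.v y)
    (hιj : ∀ x, ι (j x) = j x) (hιι : ∀ y, ι (ι y) = y) (hιv : ∀ y, Valued.v (ι y) = Valued.v y) (hσKι : ∀ y, σK (ι y) = ι (σK y))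
    {θ : K} (hθv : Valued.v θ = WithZero.exp (-1 : ℤ)) (hιθ : ι θ = -θ)
    (hcoord : ∀ z : K, ∃! pq : E × E, z = j pq.1 + j pq.2 * θ)
    {lam : K} (hquad : lam ^ 2 - j t * lam + j D = 0) (hlamO : lam ∈ 𝒪[K]) (hlam1 : Valued.v (lam - 1) < 1) (hσlam : lam * σK lam = 1) (hne : ι lam ≠ lam)
    {n N : ℕ} (hexpn : Valued.v (j u - lam) = WithZero.exp (-(n : ℤ))) (hexpN : Valued.v (lam - ι lam) = WithZero.exp (-((2 * N + 1 : ℕ) : ℤ)))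
    (hrE : ∀ x : K, x ≠ 0 → ι x = x → Even (WithZero.log (Valued.v x)))
    (hnK : ∀ c : K, c ≠ 0 → σK c = c → Even (WithZero.log (Valued.v c)) → ∃ a : K, a * σK a * c = 1)
    (hnE : ∀ c : K, c ≠ 0 → σK c = c → ι c = c → (4 : ℤ) ∣ WithZero.log (Valued.v c) → ∃ a : K, ι a = a ∧ a * σK a * c = 1) :
    (∃ w : Fin 3 → E, ∃ g ∈ unitaryGroupOfForm σ (J : Matrix (Fin 3) (Fin 3) E),
      Submodule.span 𝒪[E] (Set.range fun k : Fin 3 => (τ ^ (k : ℕ)) *ᵥ w) = Submodule.span 𝒪[E] (Set.range ((g : Matrix (Fin 3) (Fin 3) E))ᵀ)) ↔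
    Even (WithZero.log (Valued.v (∑ k, ∑ i, σ (x₀ i) * (J : Matrix (Fin 3) (Fin 3) E) i k * x₀ k)) + n) := by
  classical
  /- §0 valuation bookkeeping across the bridge `Valued.v ↔ valuation` -/
  have hO : ∀ x ∈ 𝒪[K], Valued.v x ≤ 1 := fun x hx => (v_le_one_iff_mem_integer x).2 hx
  have hjO : ∀ x : E, j x ∈ 𝒪[K] ↔ x ∈ 𝒪[E] := fun x => by
    rw [← v_le_one_iff_mem_integer, ← v_le_one_iff_mem_integer, hjv, pow_le_one_iff two_ne_zero]
  have hσKv' : ∀ y, valuation K (σK y) = valuation K y := fun y => (v_eq_iff_valuation_eq _ _).1 (hσKv y)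
  have h2K0 : (2 : K) ≠ 0 := by rw [← map_ofNat j 2]; exact (map_ne_zero j).2 h20
  have hθ0 : θ ≠ 0 := fun h => by rw [h, map_zero] at hθv; exact WithZero.exp_ne_zero hθv.symm
  /- §1 `Fix ι = j(E)` from the coordinates `z = j p + j q·θ` -/
  have hιj' : ∀ y, ι y = y ↔ ∃ x, j x = y := by
    intro y
    refine ⟨fun hy => ?_, ?_⟩
    · obtain ⟨⟨p, q⟩, hpq, -⟩ := hcoord y
      have h := hy
      rw [hpq, map_add, map_mul, hιj, hιj, hιθ] at h
      have h2q : (2 : K) * (j q * θ) = 0 := by linear_combination -h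
      have hq0 : j q = 0 := (mul_eq_zero.1 ((mul_eq_zero.1 h2q).resolve_left h2K0)).resolve_right hθ0
      exact ⟨p, by rw [hpq, hq0, zero_mul, add_zero]⟩
    · rintro ⟨x, rfl⟩
      exact hιj x
  /- §2 the eigenvalues `γ = (j u, λ, ι λ)`: non-zero, norm one, integral, `|1 + γ_i| = 1`, pairwise distinct -/
  have hσu' : σ u = u⁻¹ := eq_inv_of_mul_eq_one_left hσu
  have hu0 : u ≠ 0 := fun h => by rw [h, mul_zero] at hσu; exact zero_ne_one hσu
  have hlam0 : lam ≠ 0 := fun h => by rw [h, zero_mul] at hσlam; exact zero_ne_one hσlam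
  have hσlam' : σK lam = lam⁻¹ := eq_inv_of_mul_eq_one_right hσlam
  have hvu : Valued.v u = 1 := by
    have h := Valuation.map_one_add_of_lt (Valued.v : Valuation E ℤᵐ⁰) hu1
    rwa [add_sub_cancel] at h
  have hγO : ∀ i, (![j u, lam, ι lam] : Fin 3 → K) i ∈ 𝒪[K] := by
    intro i
    fin_cases i
    · exact (hjO u).2 ((v_le_one_iff_mem_integer u).1 hvu.le)
    · exact hlamO
    · show ι lam ∈ 𝒪[K]
      exact (v_le_one_iff_mem_integer _).1 (by rw [hιv]; exact hO _ hlamO)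
  have hσγ : ∀ i, σK ((![j u, lam, ι lam] : Fin 3 → K) i) = ((![j u, lam, ι lam] : Fin 3 → K) i)⁻¹ := by
    intro i
    fin_cases i
    · show σK (j u) = (j u)⁻¹
      rw [hσj, hσu', map_inv₀]
    · exact hσlam'
    · show σK (ι lam) = (ι lam)⁻¹
      rw [hσKι, hσlam', map_inv₀]
  have hγne : ∀ i, (![j u, lam, ι lam] : Fin 3 → K) i ≠ 0 := by
    intro i
    fin_cases i
    · exact (map_ne_zero j).2 hu0
    · exact hlam0
    · exact (map_ne_zero ι).2 hlam0
  have hγu : ∀ i, ∃ y ∈ 𝒪[K], y * (![j u, lam, ι lam] : Fin 3 → K) i = 1 := fun i =>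
    ⟨σK _, (v_le_one_iff_mem_integer _).1 (by rw [hσKv]; exact hO _ (hγO i)), by rw [hσγ, inv_mul_cancel₀ (hγne i)]⟩
  obtain ⟨r, hr⟩ := exists_poly_eval_mul_eq_one 𝒪[K] hγO hγu
  -- DEPTH ZERO `|γᵢ − 1| < 1` (the uniform core's input; replaces the tame `|1 + γᵢ| = 1`)
  have hγ1 : ∀ i, Valued.v ((![j u, lam, ι lam] : Fin 3 → K) i - 1) < 1 := by
    intro i
    fin_cases i
    · show Valued.v (j u - 1) < 1
      rw [← map_one j, ← map_sub, hjv]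
      exact pow_lt_one₀ zero_le hu1 two_ne_zero
    · exact hlam1
    · show Valued.v (ι lam - 1) < 1
      rw [← map_one ι, ← map_sub, hιv]
      exact hlam1
  have h01 : j u ≠ lam := fun h => by
    rw [h, sub_self, map_zero] at hexpn
    exact WithZero.exp_ne_zero hexpn.symm
  have h12 : lam ≠ ι lam := fun h => hne h.symm
  have h02 : j u ≠ ι lam := fun h => h01 (by rw [← hιj u, h, hιι])
  have hinj : Function.Injective (![j u, lam, ι lam] : Fin 3 → K) := by
    intro a b hab
    fin_cases a <;> fin_cases b
    all_goals
      first
      | rfl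
      | exact absurd hab h01
      | exact absurd hab.symm h01
      | exact absurd hab h02
      | exact absurd hab.symm h02
      | exact absurd hab h12
      | exact absurd hab.symm h12
  have hιγ0 : ι ((![j u, lam, ι lam] : Fin 3 → K) 0) = (![j u, lam, ι lam] : Fin 3 → K) 0 := hιj u
  have hιγ1 : ι ((![j u, lam, ι lam] : Fin 3 → K) 1) = (![j u, lam, ι lam] : Fin 3 → K) 2 := rfl
  have hιγ2 : ι ((![j u, lam, ι lam] : Fin 3 → K) 2) = (![j u, lam, ι lam] : Fin 3 → K) 1 := hιι lam
  have h01' : WithZero.log (Valued.v ((![j u, lam, ι lam] : Fin 3 → K) 0 - (![j u, lam, ι lam] : Fin 3 → K) 1)) = -(n : ℤ) := by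
    show WithZero.log (Valued.v (j u - lam)) = _
    rw [hexpn, WithZero.log_exp]
  have h12' : WithZero.log (Valued.v ((![j u, lam, ι lam] : Fin 3 → K) 1 - (![j u, lam, ι lam] : Fin 3 → K) 2)) = -((2 * N + 1 : ℕ) : ℤ) := by
    show WithZero.log (Valued.v (lam - ι lam)) = _
    rw [hexpN, WithZero.log_exp]
  /- §3 the symmetric eigenframe (★ frame) -/
  have hJdet : (J : Matrix (Fin 3) (Fin 3) E).det ≠ 0 := (Matrix.isUnits_det_units J).ne_zero
  have hlam : ((τ.map j).charpoly).IsRoot lam := by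
    rw [Matrix.charpoly_map, hχ, Polynomial.map_mul, Polynomial.root_mul]
    refine Or.inr ?_
    simp only [Polynomial.map_add, Polynomial.map_sub, Polynomial.map_mul, Polynomial.map_pow, Polynomial.map_X, Polynomial.map_C,
      Polynomial.IsRoot.def, Polynomial.eval_add, Polynomial.eval_sub, Polynomial.eval_mul, Polynomial.eval_pow, Polynomial.eval_X,
      Polynomial.eval_C]
    exact hquad
  obtain ⟨P, d₁, hτ, -, hP0, hP1, hP2, hGram, hd₁σ, hd₁0, hd₀0⟩ :=
    exists_symmetric_eigenframe j σ σK ι hσj hιj hσKι hιι hσKσK (J : Matrix (Fin 3) (Fin 3) E) hJh hJdet τ hτU hx₀ hx₀0 hlam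
      (by rw [mul_comm]; exact hσlam) hσu h01 h02 h12
  set d₀ : E := ∑ k, ∑ i, σ (x₀ i) * (J : Matrix (Fin 3) (Fin 3) E) i k * x₀ k with hd₀
  /- §4 the Gram values `d = (j d₀, d₁, ι d₁)` and the skew unit `δ = j δE` -/
  have hJki : ∀ i k, σ ((J : Matrix (Fin 3) (Fin 3) E) i k) = (J : Matrix (Fin 3) (Fin 3) E) k i := fun i k => by
    have h := congrFun (congrFun hJh k) i
    rwa [Matrix.transpose_apply, Matrix.map_apply] at h
  have hσd₀ : σ d₀ = d₀ := by
    rw [hd₀, map_sum]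
    simp_rw [map_sum, map_mul, hσσ, hJki]
    rw [Finset.sum_comm]
    refine Finset.sum_congr rfl fun a _ => Finset.sum_congr rfl fun b _ => ?_
    ring
  have hjd₀0 : j d₀ ≠ 0 := (map_ne_zero j).2 hd₀0
  have hdσ : ∀ i, σK ((![j d₀, d₁, ι d₁] : Fin 3 → K) i) = (![j d₀, d₁, ι d₁] : Fin 3 → K) i := by
    intro i
    fin_cases i
    · show σK (j d₀) = j d₀
      rw [hσj, hσd₀]
    · exact hd₁σ
    · show σK (ι d₁) = ι d₁
      rw [hσKι, hd₁σ]
  have hdne : ∀ i, (![j d₀, d₁, ι d₁] : Fin 3 → K) i ≠ 0 := by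
    intro i
    fin_cases i
    · exact hjd₀0
    · exact hd₁0
    · exact (map_ne_zero ι).2 hd₁0
  have hιd0 : ι ((![j d₀, d₁, ι d₁] : Fin 3 → K) 0) = (![j d₀, d₁, ι d₁] : Fin 3 → K) 0 := hιj d₀
  have hιd1 : ι ((![j d₀, d₁, ι d₁] : Fin 3 → K) 1) = (![j d₀, d₁, ι d₁] : Fin 3 → K) 2 := rfl
  /- §5 the parity of the frame (★ kernel): `log|j d₀|` even, `½ log|j d₀| + log|d₁|` odd -/
  have hθodd : Odd (WithZero.log (Valued.v θ)) := by
    rw [hθv, WithZero.log_exp]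
    exact ⟨-1, by norm_num⟩
  have hdetP : Odd (WithZero.log (Valued.v (P : Matrix (Fin 3) (Fin 3) K).det)) :=
    odd_log_of_map_eq_neg ι hrE hθ0 hιθ hθodd (Matrix.isUnits_det_units P).ne_zero (map_det_eq_neg_det_of_cols ι _ hP0 hP1 hP2)
  have hJK : Valued.v ((J : Matrix (Fin 3) (Fin 3) E).map j).det = 1 := by
    rw [← RingHom.mapMatrix_apply, ← RingHom.map_det, hjv, (v_eq_one_iff_valuation_eq_one _).2 (valuation_det_eq_one_of_mem_glInt hJ), one_pow]
  obtain ⟨hd0, hodd⟩ := odd_half_log_add_log_of_symmetric_frame σK hσKv (((J : Matrix (Fin 3) (Fin 3) E)).map j) (P : Matrix (Fin 3) (Fin 3) K)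
    ![j d₀, d₁, ι d₁] hGram hjd₀0 hd₁0 (by show Valued.v (ι d₁) = Valued.v d₁; exact hιv d₁) hJK hdetP
  /- §6 seam ∘ core, then `½ log|j d₀|_K = log|d₀|_E` -/
  -- the trace-one element from the seed: `b := ω ∕ (ω + σω)`
  have hωtr0 : ω + σ ω ≠ 0 := fun h => by rw [h, map_zero] at hωtr; exact zero_ne_one hωtr
  have hbO : ω / (ω + σ ω) ∈ 𝒪[E] := (v_le_one_iff_mem_integer _).1 (by rw [map_div₀, hωtr, div_one]; exact hω)
  have htr : ∃ b : 𝒪[E], (b : E) + σ b = 1 := by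
    refine ⟨⟨ω / (ω + σ ω), hbO⟩, ?_⟩
    show ω / (ω + σ ω) + σ (ω / (ω + σ ω)) = 1
    rw [map_div₀, map_add, hσσ, add_comm (σ ω) ω, ← add_div, div_self hωtr0]
  -- the seed in `K` and the parity token
  have hωK : Valued.v (j ω) ≤ 1 := by rw [hjv]; exact pow_le_one₀ zero_le hω
  have hωKtr : Valued.v (j ω + σK (j ω)) = 1 := by rw [hσj, ← map_add, hjv, hωtr, one_pow]
  have hιωK : ι (j ω) = j ω := hιj ω
  have hO' : ∀ x : K, x ∈ 𝒪[K] ↔ Valued.v x ≤ 1 := fun x => (v_le_one_iff_mem_integer x).symm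
  have hΦL : Even (WithZero.log (Valued.v ((![j d₀, d₁, ι d₁] : Fin 3 → K) 0)) / 2 + WithZero.log (Valued.v ((![j d₀, d₁, ι d₁] : Fin 3 → K) 1)) +
      (-((2 * N + 1 : ℕ) : ℤ))) := by
    obtain ⟨k, hk⟩ := hodd
    rw [hk]
    exact ⟨k - N, by push_cast; ring⟩
  refine (exists_selfDual_cyclic_iff_exists_rational_good σ hσσ hσO htr hnorm J hJ hJh τ j hjO σK hσj hσKv' ι hιι hιj' P hτ hGram hP0 hP1 hP2
    hγO hinj hσγ hr).trans ?_
  refine (exists_rational_good_iff_even_uniform 𝒪[K] hO' σK ι hσKσK hσKι hσKv hιv hnK hnE hrE hγ1 hσγ hinj hιγ0 hιγ1 hιγ2 hdσ hdne hιd0 hιd1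
    hωK hωKtr hιωK h01' h12' hd0 hΦL).trans ?_
  have hlog : WithZero.log (Valued.v ((![j d₀, d₁, ι d₁] : Fin 3 → K) 0)) / 2 = WithZero.log (Valued.v d₀) := by
    show WithZero.log (Valued.v (j d₀)) / 2 = _
    rw [hjv, WithZero.log_pow, nsmul_eq_mul, Nat.cast_ofNat, Int.mul_ediv_cancel_left _ two_ne_zero]
  rw [hlog]

end Literature.NumberTheory.Automorphic.SymmetricEigenframe

end
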